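import Mathlib
import Summits.Ventures.HodgeRepro2.T5ConductorArithmetic
import Summits.Ventures.HodgeRepro2.T6N5TateTwist
import Summits.Ventures.HodgeRepro2.T6N5Hyp
import Summits.Ventures.HodgeRepro2.T6N5LocalDatum
import Summits.Ventures.HodgeRepro2.T6N5LocalHyp
import Summits.Ventures.HodgeRepro2.T6N5Local
import Summits.Ventures.HodgeRepro2.T6N5LocalCharDatum
import Summits.Ventures.HodgeRepro2.T6N5LocalInertHyp
import Summits.Ventures.HodgeRepro2.T6N5LocalInert

/-!
# T6N5LocalInertToy — the non-vacuity witness for `T6N5LocalInert` (README §10.5(ii)(c),(d))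

A conductor-graded local sign datum on which EVERY binder of `N5LocalInert.N5Local_main_inert` holds jointly:
`E = ℕ → ℤˣ` with the filtration `U n = {f | f i = 1 for i < n}` (antitone, strictly decreasing), `F_v^× = ⊥`
(so every character is conjugate-symplectic and conjugate-orthogonal), Tate's carriers with `Psi = E`
(`ψ_a = ψ·a`), `Meas = ℝ` (`r · dx = r dx`), `ε(χ, ψ, dx) = dx · χ(ψ) · (−1)^{a(χ)+1}` — which satisfies Tate's
(3.2.2)–(3.2.3) and the conventions, and Proposition 3.1's parity rule at the normalised `ψ₀ = 1` — and the
coordinate characters `χ_i` of exact conductor `i + 1`. `toyInert_solution` applies `N5Local_main_inert` to it.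
README §8(d): uses an L-value-free non-vanishing device: NO.
-/

namespace Summit.Ventures.HodgeRepro2.T6.N5LocalInertToy

open Summit.Ventures.HodgeRepro2.T6.N5LocalDatum Summit.Ventures.HodgeRepro2.T6.N5TateTwist
  Summit.Ventures.HodgeRepro2.T5ConductorArithmetic Summit.Ventures.HodgeRepro2.T6.N5LocalCharDatum
  Summit.Ventures.HodgeRepro2.T6.N5LocalCharDatum.CharDatum
  Summit.Ventures.HodgeRepro2.T6.N5LocalInertDatum
  Summit.Ventures.HodgeRepro2.T6.N5Local Summit.Ventures.HodgeRepro2.T6.N5LocalInert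
  Summit.Ventures.HodgeRepro2.T6.Hyp

noncomputable section

/-- The toy group `E = ℕ → ℤˣ`. -/
abbrev ToyE : Type := ℕ → ℤˣ

/-- The toy filtration `U n = {f | f i = 1 for all i < n}`. -/
def toyU (n : ℕ) : Subgroup ToyE := Subgroup.pi (Set.Iio n) (fun _ => ⊥)

/-- Membership in the toy filtration. -/
theorem mem_toyU {n : ℕ} {f : ToyE} : f ∈ toyU n ↔ ∀ i, i < n → f i = 1 := by
  simp [toyU, Subgroup.mem_pi]

/-- The toy filtration is antitone. -/
theorem toyU_antitone : Antitone toyU := by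
  intro m n hmn f hf
  rw [mem_toyU] at hf ⊢
  intro i hi
  exact hf i (lt_of_lt_of_le hi hmn)

/-- The inclusion `ℤˣ →* ℂˣ`. -/
def toyInc : ℤˣ →* ℂˣ := Units.map (Int.castRingHom ℂ).toMonoidHom

/-- The inclusion `ℤˣ →* ℂˣ` is non-trivial at `−1`. -/
theorem toyInc_neg_one : toyInc (-1) ≠ 1 := by
  intro h
  have h' : ((toyInc (-1) : ℂˣ) : ℂ) = 1 := by rw [h]; rfl
  simp [toyInc] at h'
  norm_num at h'

/-- The coordinate character `χ_i : f ↦ f i`. -/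
def toyChar (i : ℕ) : ToyE →* ℂˣ := toyInc.comp (Pi.evalMonoidHom (fun _ => ℤˣ) i)

/-- Evaluation of the coordinate character. -/
theorem toyChar_apply (i : ℕ) (f : ToyE) : toyChar i f = toyInc (f i) := rfl

/-- The toy ε-factor: `ε(χ, ψ, dx) = dx · χ(ψ) · (−1)^{a(χ)+1}`. -/
def toyEps (χ : ToyE →* ℂˣ) (ψ : ToyE) (dx : ℝ) : ℂ :=
  (dx : ℂ) * ((χ ψ : ℂˣ) : ℂ) * (-1 : ℂ) ^ (conductor toyU χ + 1)

/-- The sign of the toy root number at `ψ_δ = 1` with the self-dual measure `1`: `ε_v(ξ)` of the toy. -/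
def toyEpsSign (ξ : ToyE →* ℂˣ) : ℤˣ := toSign (toyEps (ξ * 1) 1 1)

/-- The toy datum. -/
abbrev toy : InertSignDatum where
  E := ToyE
  U := toyU
  Fsub := ⊥
  η := 1
  Psi := ToyE
  Meas := ℝ
  omega := fun _ => 1
  nrm := fun _ => 1
  tw := fun ψ a => ψ * a
  sc := fun r dx => r * dx
  sd := fun _ => 1
  epsT := toyEps
  IsInert := True
  IsNormalised := fun ψ => ψ = 1
  ψ0 := 1
  ψδ := 1
  t := 1
  d := 1
  χW := 1
  epsdW := 1
  Theta := fun s α => toyEpsSign ((1 : ToyE →* ℂˣ)⁻¹ * α) = s * 1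
  ηLine := fun _ => 1
  ηu := -1

/-- `ξ · 1 = ξ` for the toy characters (pointwise). -/
theorem toy_mul_one (ξ : ToyE →* ℂˣ) : ξ * (1 : ToyE →* ℂˣ) = ξ := by
  ext x
  simp

/-- `1⁻¹ · α = α` for the toy characters (pointwise). -/
theorem toy_inv_one_mul (α : ToyE →* ℂˣ) : (1 : ToyE →* ℂˣ)⁻¹ * α = α := by
  ext x
  simp

/-- The toy root-number sign is the parity of the conductor: `ε_v(ξ) = (−1)^{a(ξ)+1}`. -/
theorem toyEpsSign_eq (ξ : ToyE →* ℂˣ) : toyEpsSign ξ = Int.negOnePow ((conductor toyU ξ : ℤ) + 1) := by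
  unfold toyEpsSign toyEps
  rw [toy_mul_one, map_one, Units.val_one]
  have : ((1 : ℝ) : ℂ) * (1 : ℂ) * (-1 : ℂ) ^ (conductor toyU ξ + 1) =
      (-1 : ℂ) ^ (((conductor toyU ξ : ℤ) + 1)) := by
    rw [← zpow_natCast]
    push_cast
    ring
  rw [this, toSign_neg_one_zpow]

/-- Every character of the toy is conjugate-symplectic (`F_v^× = ⊥`). -/
theorem toy_isCS (ξ : ToyE →* ℂˣ) : toy.toLocalSignDatum.IsCS ξ := by
  rw [isCS_iff toy.toCharDatum]
  intro x
  have hx : (x : ToyE) = 1 := Subgroup.mem_bot.mp x.2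
  show ξ x = (1 : (⊥ : Subgroup ToyE) →* ℂˣ) x
  rw [hx, map_one, MonoidHom.one_apply]

/-- Every character of the toy is conjugate-orthogonal. -/
theorem toy_isCO (ξ : ToyE →* ℂˣ) : toy.toLocalSignDatum.IsCO ξ := by
  rw [isCO_iff toy.toCharDatum]
  intro x
  have hx : (x : ToyE) = 1 := Subgroup.mem_bot.mp x.2
  rw [hx, map_one]

/-- The normalisation conventions hold on the toy (`‖·‖ = 1`, `ω_s = 1`, `dx_ψ = 1`). -/
theorem toy_conventions : toy.toCharDatum.Conventions where
  ev_omega := fun s a => by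
    show ((1 : ℂˣ) : ℂ) = ((1 : ℝ) : ℂ) ^ s
    simp
  nrm_pos := fun _ => by show (0 : ℝ) < 1; norm_num
  sd_tw := fun ψ a => by
    show (1 : ℝ) = Real.sqrt 1 * 1
    simp

/-- Tate's (3.2.2)–(3.2.3) hold for the toy ε-factor. -/
theorem toy_tate : Tate1979_3_2_2_3 toy.epsT (fun ξ a => ((ξ a : ℂˣ) : ℂ)) toy.tw toy.sc toy.nrm
    (fun _ => True) := by
  refine ⟨fun χ ψ dx r _ => ?_, fun χ ψ dx a _ => ?_⟩
  · show toyEps χ ψ (r * dx) = r * toyEps χ ψ dx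
    unfold toyEps
    push_cast
    ring
  · show toyEps χ (ψ * a) dx = ((χ a : ℂˣ) : ℂ) * ((1 : ℝ) : ℂ)⁻¹ * toyEps χ ψ dx
    unfold toyEps
    rw [map_mul, Units.val_mul]
    push_cast
    ring

/-- Proposition 3.1's parity rule holds on the toy at the normalised `ψ₀ = 1`. -/
theorem toy_GGP : GGP2012ex_Prop3_1 toy := by
  intro _ ψ hψ ξ _ _
  have hψ' : ψ = 1 := hψ
  subst hψ'
  show toyEps (ξ * 1) 1 1 = (-1 : ℂ) ^ (conductor toyU ξ + 1)
  rw [toy_mul_one]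
  unfold toyEps
  rw [map_one, Units.val_one]
  push_cast
  ring

/-- The trivial character has conductor `0` on the toy. -/
theorem toy_cond_one : conductor toyU (1 : ToyE →* ℂˣ) = 0 :=
  Nat.le_zero.mp (conductor_le_of_le_ker (fun f _ => by simp))

/-- The coordinate character `χ_{n−1}` has exact conductor `n` (`n ≥ 1`). -/
theorem toy_cond_char (n : ℕ) (hn : 1 ≤ n) : conductor toyU (toyChar (n - 1)) = n := by
  have hle : toyU n ≤ (toyChar (n - 1)).ker := fun f hf => by
    rw [MonoidHom.mem_ker, toyChar_apply, (mem_toyU.mp hf) (n - 1) (by omega), map_one]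
  have hnle : ¬ toyU (n - 1) ≤ (toyChar (n - 1)).ker := by
    intro h
    have hmem : Pi.mulSingle (n - 1) (-1 : ℤˣ) ∈ toyU (n - 1) := by
      rw [mem_toyU]
      intro i hi
      exact Pi.mulSingle_eq_of_ne (by omega) _
    have := h hmem
    rw [MonoidHom.mem_ker, toyChar_apply, Pi.mulSingle_eq_same] at this
    exact toyInc_neg_one this
  have h1 : conductor toyU (toyChar (n - 1)) ≤ n := conductor_le_of_le_ker hle
  have h2 : ¬ conductor toyU (toyChar (n - 1)) ≤ n - 1 := fun h =>
    hnle (le_ker_of_conductor_le toyU_antitone ⟨n, hle⟩ h)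
  omega

/-- The unramified character `μ = 1`: conjugate-symplectic, smooth, conductor `0`. -/
theorem toy_hμ : ∃ μ : ToyE →* ℂˣ, toy.toLocalSignDatum.IsCS μ ∧ toy.IsUnramified μ :=
  ⟨1, toy_isCS 1, fun f _ => by simp⟩

/-- Conjugate-orthogonal characters of every exact conductor `n ≥ 1` exist on the toy. -/
theorem toy_hβ (n : ℕ) (hn : 1 ≤ n) :
    ∃ β : ToyE →* ℂˣ, toy.toLocalSignDatum.IsCO β ∧ toy.IsSmooth β ∧ toy.cond β = n := by
  refine ⟨toyChar (n - 1), toy_isCO _, ⟨n, fun f hf => ?_⟩, toy_cond_char n hn⟩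
  rw [MonoidHom.mem_ker, toyChar_apply, (mem_toyU.mp hf) (n - 1) (by omega), map_one]

/-- (A1) on the toy: for each sign some character occurs (`χ_0` for `s = +1`, `μ = 1` for `s = −1`). -/
theorem toy_hA1 : ∀ s : ℤˣ, ∃ α : ToyE →* ℂˣ, toy.toLocalSignDatum.IsCO α ∧ toy.toLocalSignDatum.Theta s α := by
  intro s
  rcases Int.units_eq_one_or s with hs | hs
  · refine ⟨toyChar 0, toy_isCO _, ?_⟩
    show toyEpsSign ((1 : ToyE →* ℂˣ)⁻¹ * toyChar 0) = s * 1
    rw [toy_inv_one_mul, toyEpsSign_eq, toy_cond_char 1 le_rfl, hs, mul_one]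
    decide
  · refine ⟨1, toy_isCO _, ?_⟩
    show toyEpsSign ((1 : ToyE →* ℂˣ)⁻¹ * 1) = s * 1
    rw [toy_inv_one_mul, toyEpsSign_eq, toy_cond_one, hs, mul_one]
    decide

/-- The Epsilon Dichotomy display holds on the toy (the theta predicate is defined as its right side). -/
theorem toy_h35 : BFGYYZ2025_Thm3_5 toy.toLocalSignDatum := fun _ _ _ => Iff.rfl

/-- EVERY binder of `N5Local_main_inert` holds on the toy, and the coupled local system is solved there
(README §10.5(ii)(c),(d) for `T6N5LocalInert`). -/
theorem toyInert_solution : ∃ ξ : Fin 4 → ToyE →* ℂˣ, LocalSolution toy.toLocalSignDatum ξ :=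
  N5Local_main_inert toy toy_GGP toy_tate toy_conventions toyU_antitone (by simp)
    (Subgroup.mem_bot.mpr rfl)
    (by show ((1 : ℂˣ) : ℂ) = (-1 : ℂ) ^ ((1 : ℤ) + 1); norm_num) trivial rfl toy_hμ toy_hβ toy_h35 toy_hA1
    rfl (by ext x; simp) (toy_isCS 1)

end

end Summit.Ventures.HodgeRepro2.T6.N5LocalInertToy
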